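import Mathlib
import Summits.BirchSwinnertonDyer.BirchSwinnertonDyer.Theorems.ResidualThetaTransportAtTwoLambdaLowerBoundOExact
import HarnessLib

/-!
# The Coleman side of the one-pair count of RSL_g, piece S2 `stub_plusColemanO`: TORS + INJ + LIN + PUSH
# (`𝒸` injective on `Λ_𝒪·z` from (nz⁺) and Λ-compatibility; the product-quotient count with FIN derived)

Route `ResidualThetaTransportAtTwo` (RTT), crux RSL_g `ResidualSignedLambdaLowerCMAtTwo` (stmt-BirchSwinnertonDyer-22608); width seat
`prover-bsd-wall-tp2-p2x-w3` g15 (`--supports 22608 --as helper`, closes nothing). THEOREMS ONLY (no definition, no named fact, no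
instance, no `sorry`); pure commutative algebra. Stub plan rev 17 S72 / Q73 (second half): card `Ideas/stub-cmlambdalower-k3-g12.md`,
sketch `Cruxes/ResidualThetaCountLowerPureAtTwo/Sketch_sidea_k3_g12.lean` §1–§4, §7 transcribed here, §5–§6, §8–§9 in the sequel `…ColemanSidePush.lean` (credit: stub-ideation k3 g12), with the
sketch's `def SemilinearOnZeta` replaced by the explicit-`φ` hypothesis `hsemi`, its Λ-linear presentation `present` by the existence
theorem `exists_present` (+ lemmas about any map with that formula), and its maps `inS`/`toFst` written as the inline terms
`L.mkQ ∘ₗ LinearMap.inr A P₂ PS` / `L.mapQ (L.map (LinearMap.fst A P₂ PS)) (LinearMap.fst A P₂ PS) _`.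

WHAT IT SERVES. In the landed entry `LambdaLowerBoundO.residualSignedLambdaLowerCMAtTwo_of_parts` (p682462) the supply must turn
(nz⁺) `Module.Finite ℚ₂ (ℚ₂ ⊗ Q)` and (i_D) `f·(d+e) ≤ λ(Q)`, `Q := Λⁿ ⧸ span_Λ (𝒸 '' Λ_𝒪·z)`, `Λ = ℤ₂⟦X⟧`, `𝒸 = colⁿ ∘ locd₂`,
into the 2-ADIC SHARE (piece S2 `stub_plusColemanO` of the v2b split): FIN `Module.Finite ℚ₂ (ℚ₂ ⊗ (P ⧸ span_ℤ₂ (locd '' Z)))`,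
COUNT `f·(d+Σ+e) ≤ λ(P ⧸ span_ℤ₂ (locd '' Z))` for `P = P₂ × P_{S₀}`, and the injectivity of `𝒸` on `Z = Λ_𝒪·z`.

* §1 **TORS** (`isTorsion_of_finite_baseChange`): `K ⊗_A Λ` infinite-, `K ⊗_A M` finite-dimensional ⟹ `M` is `Λ`-torsion;
  `not_finite_baseChange_powerSeries`.
* §2 **INJ** (`injective_of_isTorsion_quotient_range`): a `Λ`-linear map between modules of the same finite rank with torsion cokernel,
  source without zero smul-divisors, is injective (rank–nullity over a domain).
* §3 **LIN ⟹ presentation** (`exists_present`, `present_coord`, `range_present`, `image_eq_range_present`): under the Λ-semilinearity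
  `hsemi : 𝒸 (j s • x) = φ s • 𝒸 x` on `Λ_𝒪·z` and `Λ`-coordinates `(bvec, crd, hsum)` of `Λ_𝒪`, the `Λ`-span of `𝒸 '' Λ_𝒪·z` is the
  range of a `Λ`-LINEAR map out of `Λ^ι`, and the image SET is already that submodule.
* §4 **TORS + INJ + LIN** (`eq_zero_of_apply_smul_zeta_eq_zero`, `injOn_span_zeta`): (nz⁺) + LIN ⟹ `𝒸 (a•z) = 0 → a = 0` — injectivity
  of `𝒸` on `Λ_𝒪·z` AND `z` non-torsion, WITHOUT Kato 12.4 (2) (the critic's U52 (b) as corrected in rev 17 S72: LIN is needed, the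
  additive counterexample of the card is valid).
* §7 the pins' currency `A = ℤ₂`, `K = ℚ₂`, `Λ = ℤ₂⟦X⟧` (`isTorsion_of_finite_baseChange_two`, `eq_zero_of_apply_smul_zeta_eq_zero_two`).
  The sequel `…ColemanSidePush.lean` carries §5 PUSH (product-quotient FIN/COUNT), §6 its providers, §8 the finite-to-full reduction
  LIN-X + LIN-C₀ ⟹ LIN and §9 the end-to-end statement. What is NOT in either file: the two single-step identities at the pins (LIN-X =
  `proj_T_smul` + (P2)_ρ + the landed Coleman twist clause — Q73, w2; LIN-C₀ = the supply's own `ℤ₂`-binder).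

References: [Washington1997] L. Washington, *Introduction to Cyclotomic Fields*, §13.2 (λ-invariants and `Λ`-ranks); [Kobayashi2003] Thm. 7.3,
§8 (8.20)–(8.23) (signed Coleman maps); [Kato2004Asterisque] Thm. 12.4; [Lang1990] S. Lang, *Cyclotomic Fields I–II*, Ch. 5 §1, Ch. 6 §2
(the Iwasawa involution). BSD is not proved by any of this; RSL_g (22608) is not proved here.
-/

set_option autoImplicit false
-- the Theorems namespace of this sub repeats the summit name by design (D-0017 nested layout)
set_option linter.dupNamespace false

noncomputable section

open scoped TensorProduct

namespace Summit.BirchSwinnertonDyer.BirchSwinnertonDyer.Theorems.ColemanSideInjective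

universe u u' v w

/-! ## §1 TORS — finite `K ⊗_A ·` forces `Λ`-torsion -/

section Torsion

variable {A : Type*} [CommRing A] (K : Type*) [Field K] [Algebra A K] [Module.Flat A K]
  {Λ : Type*} [CommRing Λ] [IsDomain Λ] [Algebra A Λ]
  {M : Type*} [AddCommGroup M] [Module Λ M] [Module A M] [IsScalarTower A Λ M]

/-- **TORS.** If `K ⊗_A Λ` is NOT finite over `K` but `K ⊗_A M` is, then every element of the `Λ`-module `M` is killed by a non-zero element
of `Λ` (else `a ↦ a•x : Λ ↪ M`, and `K ⊗_A ·` is exact). Converse companion of the landed `CharIdealLambda.finite_baseChange_of_isTorsion`.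
Credit: card k3-g12 §1. [cite: Washington1997, §13.2] -/
theorem isTorsion_of_finite_baseChange (hΛ : ¬ Module.Finite K (K ⊗[A] Λ)) [Module.Finite K (K ⊗[A] M)] :
    Module.IsTorsion Λ M := by
  intro x
  by_contra hx
  simp only [not_exists] at hx
  apply hΛ
  have hμ : Function.Injective ((LinearMap.toSpanSingleton Λ M x).restrictScalars A) := by
    rw [← LinearMap.ker_eq_bot, eq_bot_iff]
    intro a ha
    rw [LinearMap.mem_ker, LinearMap.coe_restrictScalars, LinearMap.toSpanSingleton_apply] at ha
    by_contra ha0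
    exact hx ⟨a, mem_nonZeroDivisors_of_ne_zero ha0⟩ ha
  refine Module.Finite.of_injective (((LinearMap.toSpanSingleton Λ M x).restrictScalars A).baseChange K) ?_
  rw [LinearMap.baseChange_eq_ltensor]
  exact Module.Flat.lTensor_preserves_injective_linearMap _ hμ

omit [IsDomain Λ] [Algebra A Λ] in
/-- `K ⊗_A A⟦X⟧` is not finite over `K`: it contains `K ⊗_A A[X]`, free on the monomials. Credit: card k3-g12 §1. [cite: Washington1997, §13.2] -/
theorem not_finite_baseChange_powerSeries : ¬ Module.Finite K (K ⊗[A] PowerSeries A) := by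
  intro h
  let ι : Polynomial A →ₗ[A] PowerSeries A :=
    { toFun := fun p => (p : PowerSeries A)
      map_add' := fun p q => Polynomial.coe_add p q
      map_smul' := fun c p => by simp }
  have hι : Function.Injective ι := Polynomial.coe_injective A
  have : Module.Finite K (K ⊗[A] Polynomial A) := by
    refine Module.Finite.of_injective (ι.baseChange K) ?_
    rw [LinearMap.baseChange_eq_ltensor]
    exact Module.Flat.lTensor_preserves_injective_linearMap ι hι
  have hfin := Module.Finite.finite_basis (Algebra.TensorProduct.basis K (Polynomial.basisMonomials A))
  exact @not_finite ℕ _ hfin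

end Torsion

/-! ## §2 INJ — equal finite rank + torsion cokernel ⟹ injective (rank–nullity over a domain) -/

section Injective

variable {Λ : Type u} [CommRing Λ] [IsDomain Λ]
  {N : Type v} [AddCommGroup N] [Module Λ N] {P : Type v} [AddCommGroup P] [Module Λ P]

/-- **INJ (U52 (b) of the stub plan as a standalone algebra fact).** A `Λ`-linear map between modules of the same finite rank `n` whose cokernel
is torsion is injective, provided the source has no zero smul-divisors: `rank (range ψ) = rank P = n` (torsion quotient), so `rank (ker ψ) = 0`,
so `ker ψ` is torsion, so `ker ψ = 0`. Credit: card k3-g12 §2. [cite: Washington1997, §13.2] -/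
theorem injective_of_isTorsion_quotient_range
    (hN : ∀ (a : Λ) (x : N), a • x = 0 → a = 0 ∨ x = 0) (ψ : N →ₗ[Λ] P) (n : ℕ)
    (hrN : Module.rank Λ N = n) (hrP : Module.rank Λ P = n)
    (htors : Module.IsTorsion Λ (P ⧸ LinearMap.range ψ)) : Function.Injective ψ := by
  have h1 := LinearMap.rank_range_add_rank_ker ψ
  have h2 := Submodule.rank_quotient_add_rank (LinearMap.range ψ)
  rw [rank_eq_zero_iff_isTorsion.mpr htors, zero_add] at h2
  rw [h2, hrP, hrN] at h1
  have hker : Module.rank Λ (LinearMap.ker ψ) = 0 := by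
    have hle : Module.rank Λ (LinearMap.ker ψ) ≤ n := (Submodule.rank_le (LinearMap.ker ψ)).trans hrN.le
    obtain ⟨m, hm⟩ := Cardinal.lt_aleph0.mp (hle.trans_lt (Cardinal.natCast_lt_aleph0 (n := n)))
    rw [hm] at h1 ⊢
    have hnm : n + m = n := by exact_mod_cast h1
    have hm0 : m = 0 := by omega
    simp [hm0]
  rw [← LinearMap.ker_eq_bot, eq_bot_iff]
  intro x hx
  obtain ⟨a, ha⟩ := (rank_eq_zero_iff_isTorsion.mp hker) (x := ⟨x, hx⟩)
  have ha' : ((a : Λ) • (⟨x, hx⟩ : LinearMap.ker ψ) : LinearMap.ker ψ) = 0 := ha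
  have ha'' : (a : Λ) • x = 0 := by simpa using congrArg Subtype.val ha'
  rcases hN _ _ ha'' with h | h
  · exact absurd h (nonZeroDivisors.coe_ne_zero a)
  · simpa using h

omit [IsDomain Λ] in
/-- `Λⁿ` has no zero smul-divisors over a ring `Λ` without zero divisors (coordinatewise). Credit: card k3-g12 §2. [cite: Washington1997, §13.2] -/
theorem smul_eq_zero_pi [NoZeroDivisors Λ] {n : ℕ} (a : Λ) (x : Fin n → Λ) (h : a • x = 0) : a = 0 ∨ x = 0 := by
  refine or_iff_not_imp_left.mpr fun ha => funext fun i => ?_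
  have hi : a * x i = 0 := by
    have := congrFun h i
    simpa only [Pi.smul_apply, smul_eq_mul, Pi.zero_apply] using this
  exact (mul_eq_zero.mp hi).resolve_left ha

end Injective

/-! ## §3 LIN ⟹ the Λ-linear presentation of `𝒸 '' Λ_𝒪·z` -/

section Presentation

variable {Λ : Type u} [CommRing Λ] {ΛO : Type u'} [CommRing ΛO]
  {H : Type v} [AddCommGroup H] [Module ΛO H] {V : Type w} [AddCommGroup V] [Module Λ V]
  (j : Λ →+* ΛO) (𝒸 : H →+ V) (z : H) (φ : Λ ≃+* Λ)
  (hsemi : ∀ (s : Λ) (x : H), x ∈ Submodule.span ΛO ({z} : Set H) → 𝒸 (j s • x) = φ s • 𝒸 x)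
  {ι : Type*} [Fintype ι] (bvec : ι → ΛO) (crd : ΛO →+ (ι → Λ))
  (hsum : ∀ a : ΛO, ∑ i, j (crd a i) * bvec i = a)

include hsemi in
/-- **LIN ⟹ the Λ-linear presentation** `ν ↦ 𝒸 ((∑ᵢ j(φ⁻¹ νᵢ)·bᵢ)•z)` of `a ↦ 𝒸 (a•z)` through `Λ`-coordinates `(bᵢ)` of `Λ_𝒪`, untwisted by
`φ⁻¹` so that it is `Λ`-LINEAR (not merely semilinear) — here `hsemi` is the Λ-semilinearity of `𝒸` on `Λ_𝒪·z` along the ring automorphism `φ`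
(`φ = id` at the pins). Credit: card k3-g12 §3 (`present`). [cite: Lang1990, Ch. 6 §2 (p. 111)] -/
theorem exists_present : ∃ Φ : (ι → Λ) →ₗ[Λ] V, ∀ ν, Φ ν = 𝒸 ((∑ i, j (φ.symm (ν i)) * bvec i) • z) := by
  refine ⟨{ toFun := fun ν ↦ 𝒸 ((∑ i, j (φ.symm (ν i)) * bvec i) • z), map_add' := fun ν ν' ↦ ?_, map_smul' := fun r ν ↦ ?_ },
    fun _ ↦ rfl⟩
  · have hs : (∑ i, j (φ.symm ((ν + ν') i)) * bvec i)
        = (∑ i, j (φ.symm (ν i)) * bvec i) + ∑ i, j (φ.symm (ν' i)) * bvec i := by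
      rw [← Finset.sum_add_distrib]
      exact Finset.sum_congr rfl fun i _ => by rw [Pi.add_apply, map_add, map_add, add_mul]
    rw [hs, add_smul, map_add]
  · have hs : (∑ i, j (φ.symm ((r • ν) i)) * bvec i)
        = j (φ.symm r) * ∑ i, j (φ.symm (ν i)) * bvec i := by
      rw [Finset.mul_sum]
      exact Finset.sum_congr rfl fun i _ => by rw [Pi.smul_apply, smul_eq_mul, map_mul, map_mul, mul_assoc]
    rw [RingHom.id_apply, hs, mul_smul,
      hsemi _ _ (Submodule.smul_mem _ _ (Submodule.mem_span_singleton_self z)), RingEquiv.apply_symm_apply]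

variable (Φ : (ι → Λ) →ₗ[Λ] V) (hΦ : ∀ ν, Φ ν = 𝒸 ((∑ i, j (φ.symm (ν i)) * bvec i) • z))

include hΦ hsum in
/-- On the (twisted) coordinates of `a`, the presentation returns `𝒸 (a•z)`. Credit: card k3-g12 §3. [cite: Lang1990, Ch. 6 §2 (p. 111)] -/
theorem present_coord (a : ΛO) : Φ (fun i => φ (crd a i)) = 𝒸 (a • z) := by
  rw [hΦ]
  simp only [RingEquiv.symm_apply_apply]
  rw [hsum a]

include hΦ hsum in
/-- **`range Φ = span_Λ (𝒸 '' Λ_𝒪·z)`** — the Λ-span in the definition of `Q` of (nz⁺) IS the range of a Λ-linear map out of the free module `Λ^ι`.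
Credit: card k3-g12 §3. [cite: Washington1997, §13.2] -/
theorem range_present :
    LinearMap.range Φ = Submodule.span Λ (𝒸 '' (Submodule.span ΛO ({z} : Set H) : Set H)) := by
  apply le_antisymm
  · rintro _ ⟨ν, rfl⟩
    rw [hΦ]
    exact Submodule.subset_span ⟨_, Submodule.smul_mem _ _ (Submodule.mem_span_singleton_self z), rfl⟩
  · rw [Submodule.span_le]
    rintro _ ⟨x, hx, rfl⟩
    obtain ⟨a, rfl⟩ := Submodule.mem_span_singleton.mp hx
    exact ⟨fun i => φ (crd a i), present_coord j 𝒸 z φ bvec crd hsum Φ hΦ a⟩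

include hΦ hsum in
/-- The image SET `𝒸 '' Λ_𝒪·z` is already the carrier of the Λ-submodule `range Φ` (so its `ℤ₂`-span, its `Λ`-span and itself coincide — the
Λ-STABILITY the count at `2` needs). Credit: card k3-g12 §3. [cite: Washington1997, §13.2] -/
theorem image_eq_range_present :
    𝒸 '' (Submodule.span ΛO ({z} : Set H) : Set H) = (LinearMap.range Φ : Set V) := by
  apply Set.Subset.antisymm
  · rintro _ ⟨x, hx, rfl⟩
    obtain ⟨a, rfl⟩ := Submodule.mem_span_singleton.mp hx
    exact ⟨fun i => φ (crd a i), present_coord j 𝒸 z φ bvec crd hsum Φ hΦ a⟩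
  · rintro _ ⟨ν, rfl⟩
    rw [hΦ]
    exact ⟨_, Submodule.smul_mem _ _ (Submodule.mem_span_singleton_self z), rfl⟩

end Presentation

/-! ## §4 TORS + INJ + LIN ⟹ `𝒸 (a•z) = 0 → a = 0` (injectivity on `Λ_𝒪·z` AND `z` non-torsion, K0b-free) -/

section InjOnZeta

variable {A : Type*} [CommRing A] (K : Type*) [Field K] [Algebra A K] [Module.Flat A K]
  {Λ : Type u} [CommRing Λ] [IsDomain Λ] [Algebra A Λ]
  {ΛO : Type u'} [CommRing ΛO] {H : Type v} [AddCommGroup H] [Module ΛO H] {n : ℕ}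
  (j : Λ →+* ΛO) (𝒸 : H →+ (Fin n → Λ)) (z : H) (φ : Λ ≃+* Λ)
  (hsemi : ∀ (s : Λ) (x : H), x ∈ Submodule.span ΛO ({z} : Set H) → 𝒸 (j s • x) = φ s • 𝒸 x)
  (bvec : Fin n → ΛO) (crd : ΛO →+ (Fin n → Λ))
  (hsum : ∀ a : ΛO, ∑ i, j (crd a i) * bvec i = a)

include hsemi hsum in
/-- **INJ on `Λ_𝒪·z` from (nz⁺) alone (given LIN).** If `K ⊗_A Λ` is infinite-dimensional and `K ⊗_A (Λⁿ ⧸ span_Λ (𝒸 '' Λ_𝒪·z))` is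
finite-dimensional, then `𝒸 (a•z) = 0 → a = 0` for every `a ∈ Λ_𝒪` — in particular `z` is non-torsion and `𝒸` is injective on `Λ_𝒪·z`. Here
`Λ_𝒪` has `Λ`-coordinates `crd` with `n` basis vectors `bvec` (at the pins: `n = f = [𝒪 : ℤ₂]`, from the HOLD's additive basis `B`).
Credit: card k3-g12 §4. [cite: Washington1997, §13.2] [cite: Kato2004Asterisque, Thm. 12.4] -/
theorem eq_zero_of_apply_smul_zeta_eq_zero (hΛ : ¬ Module.Finite K (K ⊗[A] Λ))
    [Module.Finite K (K ⊗[A] ((Fin n → Λ) ⧸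
      Submodule.span Λ (𝒸 '' (Submodule.span ΛO ({z} : Set H) : Set H))))]
    (a : ΛO) (ha : 𝒸 (a • z) = 0) : a = 0 := by
  obtain ⟨Φ, hΦ⟩ := exists_present j 𝒸 z φ hsemi bvec
  have htors : Module.IsTorsion Λ ((Fin n → Λ) ⧸ LinearMap.range Φ) := by
    rw [range_present j 𝒸 z φ bvec crd hsum Φ hΦ]
    exact isTorsion_of_finite_baseChange K hΛ
  have hinj : Function.Injective Φ :=
    injective_of_isTorsion_quotient_range (fun c x h => smul_eq_zero_pi c x h) _ n
      (rank_fin_fun n) (rank_fin_fun n) htors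
  have h0 : Φ (fun i => φ (crd a i)) = Φ 0 := by
    rw [present_coord j 𝒸 z φ bvec crd hsum Φ hΦ, map_zero, ha]
  have hν := hinj h0
  have hcrd : crd a = 0 := by
    funext i
    have := congrFun hν i
    simpa using this
  rw [← hsum a, hcrd]
  simp

include hsemi hsum in
/-- Corollary: `𝒸` is injective on `Λ_𝒪·z`. Credit: card k3-g12 §4. [cite: Washington1997, §13.2] -/
theorem injOn_span_zeta (hΛ : ¬ Module.Finite K (K ⊗[A] Λ))
    [Module.Finite K (K ⊗[A] ((Fin n → Λ) ⧸
      Submodule.span Λ (𝒸 '' (Submodule.span ΛO ({z} : Set H) : Set H))))] :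
    ∀ x ∈ Submodule.span ΛO ({z} : Set H), 𝒸 x = 0 → x = 0 := by
  intro x hx h
  obtain ⟨a, rfl⟩ := Submodule.mem_span_singleton.mp hx
  rw [eq_zero_of_apply_smul_zeta_eq_zero K j 𝒸 z φ hsemi bvec crd hsum hΛ a h, zero_smul]

end InjOnZeta

/-! ## §7 At the pins' currency: `A = ℤ₂`, `K = ℚ₂`, `Λ = ℤ₂⟦X⟧` -/

section AtTwo

/-- **TORS at 2**: a `ℤ₂⟦X⟧`-module with `ℚ₂ ⊗_{ℤ₂} M` finite-dimensional is `ℤ₂⟦X⟧`-torsion; applied to `M = Q = Λⁿ ⧸ span_Λ (𝒸 '' Λ_𝒪·z)` this is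
"(nz⁺) ⟹ `Q` torsion". Credit: card k3-g12 §7. [cite: Washington1997, §13.2] -/
theorem isTorsion_of_finite_baseChange_two {M : Type*} [AddCommGroup M] [Module (PowerSeries ℤ_[2]) M]
    [Module ℤ_[2] M] [IsScalarTower ℤ_[2] (PowerSeries ℤ_[2]) M]
    [Module.Finite ℚ_[2] (ℚ_[2] ⊗[ℤ_[2]] M)] : Module.IsTorsion (PowerSeries ℤ_[2]) M := by
  haveI : Module.Flat ℤ_[2] ℚ_[2] := IsLocalization.flat ℚ_[2] (nonZeroDivisors ℤ_[2])
  exact isTorsion_of_finite_baseChange ℚ_[2] (not_finite_baseChange_powerSeries ℚ_[2])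

/-- **INJ at 2 (the K0b-free replacement of the orphan hypothesis, given LIN)**: in the currency of (nz⁺) of `residualSignedLambdaLowerCMAtTwo_of_parts` —
`Λ = ℤ₂⟦X⟧`, `Q = (Fin n → Λ) ⧸ span_Λ (𝒸 '' ↑(span_{Λ_𝒪} {z}))` — (nz⁺) and LIN give `𝒸 (a•z) = 0 → a = 0` on `Λ_𝒪`. Credit: card k3-g12 §7.
[cite: Kato2004Asterisque, Thm. 12.4] [cite: Washington1997, §13.2] -/
theorem eq_zero_of_apply_smul_zeta_eq_zero_two {ΛO : Type u'} [CommRing ΛO] {H : Type v} [AddCommGroup H]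
    [Module ΛO H] {n : ℕ} (j : PowerSeries ℤ_[2] →+* ΛO) (𝒸 : H →+ (Fin n → PowerSeries ℤ_[2])) (z : H)
    (φ : PowerSeries ℤ_[2] ≃+* PowerSeries ℤ_[2])
    (hsemi : ∀ (s : PowerSeries ℤ_[2]) (x : H), x ∈ Submodule.span ΛO ({z} : Set H) →
      𝒸 (j s • x) = φ s • 𝒸 x)
    (bvec : Fin n → ΛO) (crd : ΛO →+ (Fin n → PowerSeries ℤ_[2]))
    (hsum : ∀ a : ΛO, ∑ i, j (crd a i) * bvec i = a)
    [Module.Finite ℚ_[2] (ℚ_[2] ⊗[ℤ_[2]] ((Fin n → PowerSeries ℤ_[2]) ⧸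
      Submodule.span (PowerSeries ℤ_[2]) (𝒸 '' (Submodule.span ΛO ({z} : Set H) : Set H))))]
    (a : ΛO) (ha : 𝒸 (a • z) = 0) : a = 0 := by
  haveI : Module.Flat ℤ_[2] ℚ_[2] := IsLocalization.flat ℚ_[2] (nonZeroDivisors ℤ_[2])
  exact eq_zero_of_apply_smul_zeta_eq_zero ℚ_[2] j 𝒸 z φ hsemi bvec crd hsum
    (not_finite_baseChange_powerSeries ℚ_[2]) a ha

end AtTwo

end Summit.BirchSwinnertonDyer.BirchSwinnertonDyer.Theorems.ColemanSideInjective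

end
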